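import Literature.Probability.Percolation.GMFiniteSize
import Literature.Probability.Percolation.UniquenessZone
import HarnessLib

/-!
# QUANT lane, statement (R6/O1): the JUNCTION INPUT `(J)` a polynomial Lemma 10 would need

builds on p205010 (kernel theorem, internal audit signed; external expert review pending)

Cell `prim-quant` (post-continuity programme, LANE 1), seat `prim-quant-p2` (METHOD = effective Kozma–Nitzan reduction),
memo `run/shared/lean/prim/quant/P2-EFFECTIVE-KN.md` §7.4–§7.5.  STATEMENT ONLY — nothing in the tree consumes it and
nothing here claims it holds.  Memo §7 shows that Kozma–Nitzan's Lemma 10 (arXiv:2401.12397 §4, tree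
`KozmaNitzanTargetLemma.lean`) can have a polynomial margin `R` only if the junction between the explored cluster's contact
vertex and the zone cube `v + Λ_M` is made at (essentially) a POINT `w` of the cube's face instead of through a fully open
plaquette of side `2M+1` (whose cost `p^{(2d+1)(2M+3)^d}` is obstruction O1), and that Step IV then needs, AT CONSTANT
TOLERANCE `δ` (the tolerance no-go `Quant.exp_le_prod_one_sub_of_inv_log`), the conditional-uniqueness input typed here:

* `Quant.JunctionInputAt d p m M δ` — for every vertex `w` of the inner vertex boundary of `Λ_M`:
  `P_p({w ↔ Λ_m in Λ_M} ∩ (uniqZone m M)ᶜ) ≤ δ · P_p(w ↔ Λ_m in Λ_M)`,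
  i.e. GIVEN the (polynomially unlikely) arm from the face point `w` to the core `Λ_m` inside `Λ_M`, the uniqueness zone
  `(m, M)` still holds with conditional probability `≥ 1 − δ`.

Status (memo §7.4): `(J)` at constant `δ` follows from an exponent inequality of the lead's type (X2) — uniqueness-zone
failure decaying in the aspect `M/m` FASTER than the face-point-to-core arm probability, with explicit constants — which is
not in print for `d ≥ 3` (planar analogue: `Literature/…/TwoArmVersusOneArm.lean`); the BK inequality only gives
`P((uniqZone m M)ᶜ | arm) ≤ P(Λ_m ↔ ∂Λ_M) ≈ 1`; a union bound with DKT's `M^{-α}` would need `α > d − 1`.  By memo §7.5,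
`(J)` is one of TWO missing inputs of a polynomial Lemma 10 (the other, a many-contacts mechanism compatible with Step V, is
not even an admissible same-density input), so this file does NOT assert that `(J)` implies any rate.
Sanity lemmas: `junctionInputAt_one` (δ = 1 always holds), `JunctionInputAt.mono` (monotone in δ).
[cite: KozmaNitzan2024, §4 pp. 19–21 (Step IV: the zone cube, (21)–(24))] [cite: MartineauTassion2017, §3.1.2 (uniqueness zone)]
-/

noncomputable section

namespace Summit.CriticalPhenomena.PercolationContinuityZ3.Theorems.Quant

open MeasureTheory Literature.Probability.LatticeModels Literature.Probability.Percolation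

variable {d : ℕ}

/-- **The junction input `(J)` at scales `(m, M)`, density `p`, tolerance `δ`** (memo P2-EFFECTIVE-KN.md §7.4): for every
vertex `w` of the inner vertex boundary `∂ⁱⁿΛ_M`, the probability that `w` is joined to the core `Λ_m` inside `Λ_M` while the
uniqueness zone `uniqZone m M` FAILS is at most `δ` times the probability of that arm:
`P_p(linkEvent {w} Λ_m M ∩ (uniqZone m M)ᶜ) ≤ δ · P_p(linkEvent {w} Λ_m M)`.
This is what Step IV of a polynomial (point-junction) Lemma 10 needs at CONSTANT `δ`; it is an OPEN finite-size input, typed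
here for the planner, implied by an (X2)-type exponent inequality with constants and by nothing in the tree.
builds on p205010 (kernel theorem, internal audit signed; external expert review pending).
[cite: KozmaNitzan2024, §4 pp. 19–21 (Step IV)] -/
def JunctionInputAt (d : ℕ) (p : unitInterval) (m M : ℕ) (δ : ℝ) : Prop :=
  ∀ w ∈ innerBoundary (zdGraph d) (box d M),
    (bondPercolation (zdGraph d) p).real (linkEvent {w} (box d m) M ∩ (uniqZone m M)ᶜ) ≤
      δ * (bondPercolation (zdGraph d) p).real (linkEvent {w} (box d m) M)

/-- `(J)` holds trivially with `δ = 1`: `P(A ∩ Bᶜ) ≤ P(A)`. [folklore] -/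
theorem junctionInputAt_one (d : ℕ) (p : unitInterval) (m M : ℕ) : JunctionInputAt d p m M 1 := by
  intro w _
  rw [one_mul]
  exact measureReal_mono Set.inter_subset_left (measure_ne_top _ _)

/-- `(J)` is monotone in the tolerance. [folklore] -/
theorem JunctionInputAt.mono {p : unitInterval} {m M : ℕ} {δ δ' : ℝ} (h : JunctionInputAt d p m M δ) (hδ : δ ≤ δ') :
    JunctionInputAt d p m M δ' := fun w hw =>
  (h w hw).trans (mul_le_mul_of_nonneg_right hδ measureReal_nonneg)

end Summit.CriticalPhenomena.PercolationContinuityZ3.Theorems.Quant
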